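import Literature.Computability.MetaComplexity.EFSemModular
import Literature.Computability.MetaComplexity.EFModExpU
import HarnessLib

/-!
# Semantics of the exponentiation kit: `ModExpU.expT` computes `z ^ w mod n`

Continuing `EFSemModular.lean` (the modular adder adds, the multiplier multiplies), this file
computes the words of the uniform modular exponentiation kit `ModExpU.expT L`
(`EFModExpU.lean`: inputs `z, w, n` of `L` bits and a zero input `zz`; repeated squares
`S₀ = z`, `S_{t+1} = S_t ⊗ S_t`, selections `G_t = w_t ? S_t : 1`, accumulations `F₀ = 1`,
`F_{t+1} = F_t ⊗ G_t`) on honest inputs `z < n`, `2 ≤ n`, `2n ≤ 2^L`, `zz = 0`: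

* `ModExpU.valS_eq` — `S_t` carries `z^(2^t) mod n` (`t < L`);
* `ModExpU.valG_eq` — `G_t` carries `S_t` if `w_t` is set and `1` otherwise;
* `ModExpU.valF_eq` — `F_t` carries `z^(w mod 2^t) mod n` (`t ≤ L`);
* `ModExpU.wval_expT` — **the output word `F_L` carries `z ^ w mod n`**.

These are the covering-side facts for constraint lists mentioning `E(z, w) = F_L`
(`ModExpU.Fw L o L`), transported to occurrences by `Netlist.Inst.assign_wire`.

## Sources

* H. Vollmer, *Introduction to Circuit Complexity* (Springer 1999), §1.2–1.3 (iterated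
  multiplication, exponentiation by repeated squaring as straight-line programs), Def. 1.7.
-/

namespace Literature.Computability.MetaComplexity

open _root_.Computability Complexity Complexity.PropForm Netlist

namespace ModMulU

/-- `LD.pP` is `posP` shifted by the offset of the multiplier. [folklore] -/
theorem pP_eq_posP (L oV s i : ℕ) : LD.pP L oV s i = oV + posP L s i := by
  unfold LD.pP posP; split_ifs <;> omega

/-- The positions of the partial products lie inside the certified multiplier. [folklore] -/
theorem posP_lt_length_mulRT (L : ℕ) {s i : ℕ} (hs : s ≤ L) (hi : i < L) : posP L s i < (mulRT L).length :=
  (posP_lt_length L hs hi).trans_le (by simp [ML])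

/-! ### The degenerate modulus `n = 1`

For the covering property at the modulus `n = 1` (the triples `(1, 1, y)` belong to the RSA set
`A₀`) one needs what the multiplier computes outside the hypotheses `a < n`: with `n = 1` and a
multiplicand `a ≤ 1` every partial product is the zero word. -/

/-- **At modulus `1` a multiplicand `≤ 1` gives zero partial products.** [folklore] -/
theorem valP_eq_zero_of_n_one (L : ℕ) (inp : ℕ → Bool) (hn : valN L inp = 1) (ha : valA L inp ≤ 1) (hL : 0 < L) :
    ∀ {s : ℕ}, s ≤ L → valP L inp s = 0
  | 0, _ => valP_zero L inp
  | s + 1, hs => by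
    have ih := valP_eq_zero_of_n_one L inp hn ha hL (s := s) (by omega)
    have h2L : 2 ≤ 2 ^ L := by
      calc (2 : ℕ) = 2 ^ 1 := by norm_num
        _ ≤ 2 ^ L := Nat.pow_le_pow_right (by norm_num) hL
    have hRD := wval_RD_mulT L inp (s := s) (by omega) (by rw [ih, hn]; exact Nat.one_pos) (by rw [hn]; exact h2L)
    rw [ih, Nat.mul_zero, Nat.zero_mod] at hRD
    have hM := wval_M_mulT L inp (s := s) (by omega)
    obtain ⟨hA, hB, hN⟩ := val_inpA L inp s
    have hMle : ModAddU.valB L (inpA L inp s) ≤ 1 := by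
      rw [hB, hM]; exact (Nat.mul_le_mul (toNat_le_one _) ha).trans (by norm_num)
    have h := ModAddU.wval_R_modAddT L (inpA L inp s) (by rw [hA, hRD]; omega)
    rw [hA, hRD, hN, hn, Nat.zero_add] at h
    have e : valP L inp (s + 1) = wval (fun i => wireVal (ModAddU.modAddT L) (inpA L inp s) (5 * L + 2 + i)) L :=
      wval_congr fun i hi => by rw [posP_succ, Nat.add_assoc]; exact wireVal_mulT_A L inp (by omega) (j := 5 * L + 2 + i) (by simp; omega)
    rw [e, h]
    split_ifs with hc <;> omega

/-- **At modulus `1` the certified multiplier outputs zero** for a multiplicand `≤ 1`. [folklore] -/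
theorem wval_mulRT_of_n_one (L : ℕ) (inp : ℕ → Bool) (hn : valN L inp = 1) (ha : valA L inp ≤ 1) (hL : 0 < L) :
    wval (fun i => wireVal (mulRT L) inp (posP L L i)) L = 0 := by
  rw [wval_P_mulRT L inp L le_rfl, valP_eq_zero_of_n_one L inp hn ha hL le_rfl]

end ModMulU

namespace ModExpU

open ModMulU

variable (L : ℕ) (inp : ℕ → Bool)

/-! ### The values -/

/-- The base `z` (inputs `0 … L-1`). [folklore] -/
def valZ : ℕ := wval (fun i => inp i) L
/-- The exponent `w` (inputs `L … 2L-1`). [folklore] -/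
def valW : ℕ := wval (fun i => inp (L + i)) L
/-- The modulus `n` (inputs `2L … 3L-1`). [folklore] -/
def valN : ℕ := wval (fun i => inp (2 * L + i)) L
/-- The value read through a reference of the kit (an input or a gate). [folklore] -/
def rv (r : ℕ ⊕ ℕ) : Bool := refVal inp (wireVal (expT L) inp) r
/-- The number carried by `S_t`. [folklore] -/
def valS (t : ℕ) : ℕ := wval (fun i => rv L inp (Sref L t i)) L
/-- The number carried by the word `1`. [folklore] -/
def valONE : ℕ := wval (fun i => rv L inp (ONEref L i)) L
/-- The number carried by `G_t`. [folklore] -/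
def valG (t : ℕ) : ℕ := wval (fun i => rv L inp (Gref L t i)) L
/-- The number carried by `F_t`. [folklore] -/
def valF (t : ℕ) : ℕ := wval (fun i => rv L inp (Fref L t i)) L

/-! ### The pieces -/

/-- Piece `t + 1 < L` is the squaring `S_{t+1}`. [folklore] -/
theorem pieces_S {t : ℕ} (ht : t + 1 < L) : pieces L (t + 1) = ⟨mulRT L, 3 * L, wS L t⟩ := by
  unfold pieces; rw [if_neg (by omega), if_pos ht, Nat.add_sub_cancel]

/-- Piece `L + t` is the mux row `G_t`. [folklore] -/
theorem pieces_G {t : ℕ} (ht : t < L) : pieces L (L + t) = ⟨ModAdd.muxRow L, 2 * L + 1, wG L t⟩ := by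
  unfold pieces; rw [if_neg (by omega), if_neg (by omega), if_pos (by omega), Nat.add_sub_cancel_left]

/-- Piece `2L + t` is the accumulation `F_{t+1}`. [folklore] -/
theorem pieces_F {t : ℕ} (ht : t < L) : pieces L (2 * L + t) = ⟨mulRT L, 3 * L, wF L t⟩ := by
  unfold pieces; rw [if_neg (by omega), if_neg (by omega), if_neg (by omega), Nat.add_sub_cancel_left]

/-- **The wires of piece `k`** carry the wires of its template on the values it reads.
[cite: Vollmer1999, Def. 1.7] -/
theorem wireVal_piece (hL : 0 < L) {k : ℕ} (hk : k < 3 * L) {j : ℕ} (hj : j < (pieces L k).T.length) :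
    wireVal (expT L) inp (offF L k + j) = wireVal (pieces L k).T (fun i => rv L inp ((pieces L k).wire i)) j := by
  have h := wireVal_layout (pieces L) (N := 3 * L) (piece_ok L hL) inp hk hj
  rw [offset_pieces L hL k hk.le] at h
  exact h

/-- **The true gate** is `true`. [folklore] -/
theorem wireVal_og (hL : 0 < L) : wireVal (expT L) inp 0 = true := by
  have h := wireVal_piece L inp hL (k := 0) (by omega) (j := 0) (by simp [pieces])
  have h0 : offF L 0 = 0 := by simp [offF]
  rw [h0] at h
  rw [h, wireVal_eq (nIn := 0) (by
    intro j hj; simp only [pieces, if_true, List.length_singleton, Nat.lt_one_iff] at hj; subst hj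
    exact ⟨rfl, fun a ha => absurd ha (by simp [pieces])⟩) _ (by simp [pieces])]
  simp [pieces, Kind.fn]

/-- **The word `1` carries `1`** (the true gate, then copies of the zero input `zz = 0`).
[folklore] -/
theorem valONE_eq (hL : 0 < L) (hzz : inp (3 * L) = false) : valONE L inp = 1 :=
  wval_onehot hL fun i _ => by
    unfold rv ONEref
    by_cases h : i = 0
    · subst h; simpa [refVal] using wireVal_og L inp hL
    · simp [refVal, h, hzz]

/-- `S_0` is `z`. [folklore] -/
theorem valS_zero : valS L inp 0 = valZ L inp := wval_congr fun i _ => by simp [rv, Sref, refVal]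

/-- `F_0` is the word `1`. [folklore] -/
theorem valF_zero : valF L inp 0 = valONE L inp := wval_congr fun i _ => by simp [rv, Fref]

/-- The inputs read by the squaring `S_{t+1}`: `(S_t, S_t, n)`. [folklore] -/
def inpS (t : ℕ) (i : ℕ) : Bool := if i < L then rv L inp (Sref L t i) else if i < 2 * L then rv L inp (Sref L t (i - L)) else inp i

/-- **The squaring `S_{t+1}`** carries the wires of `mulRT L` on `(S_t, S_t, n)`.
[cite: Vollmer1999, Def. 1.7] -/
theorem wireVal_S (hL : 0 < L) {t : ℕ} (ht : t + 1 < L) {j : ℕ} (hj : j < (mulRT L).length) :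
    wireVal (expT L) inp (offF L (t + 1) + j) = wireVal (mulRT L) (inpS L inp t) j := by
  have h := wireVal_piece L inp hL (k := t + 1) (by omega) (j := j) (by rw [pieces_S L ht]; exact hj)
  rw [pieces_S L ht] at h
  refine h.trans (wireVal_congr (wf_mulRT L) (fun i hi => ?_) hj)
  show rv L inp (wS L t i) = inpS L inp t i
  unfold wS inpS; split_ifs <;> rfl

/-- The operands of `S_{t+1}` carry `S_t`, `S_t`, `n`. [folklore] -/
theorem val_inpS (t : ℕ) :
    ModMulU.valA L (inpS L inp t) = valS L inp t ∧ ModMulU.valB L (inpS L inp t) = valS L inp t ∧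
      ModMulU.valN L (inpS L inp t) = valN L inp := by
  refine ⟨wval_congr fun i hi => ?_, wval_congr fun i hi => ?_, wval_congr fun i hi => ?_⟩ <;> unfold inpS
  · rw [if_pos hi]
  · rw [if_neg (by omega), if_pos (by omega), Nat.add_sub_cancel_left]
  · rw [if_neg (by omega), if_neg (by omega)]

/-- **One squaring**: `S_{t+1} = S_t² mod n` (for `S_t < n`, `2n ≤ 2^L`). [cite: Vollmer1999, §1.3] -/
theorem valS_succ (hL : 0 < L) {t : ℕ} (ht : t + 1 < L) (hS : valS L inp t < valN L inp) (hn : 2 * valN L inp ≤ 2 ^ L) :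
    valS L inp (t + 1) = (valS L inp t * valS L inp t) % valN L inp := by
  obtain ⟨hA, hB, hN⟩ := val_inpS L inp t
  have h := wval_mulRT L (inpS L inp t) (by rw [hA, hN]; exact hS) (by rw [hN]; exact hn)
  rw [hA, hB, hN] at h
  rw [← h]
  refine wval_congr fun i hi => ?_
  have e : LD.pP L (1 + (t + 1 - 1) * LD.RT L) L i = offF L (t + 1) + posP L L i := by
    rw [pP_eq_posP, offF_S L (by omega) (by omega)]
  simp only [rv, Sref, Nat.add_eq_zero_iff, one_ne_zero, and_false, if_false, refVal, e]
  exact wireVal_S L inp hL ht (posP_lt_length_mulRT L le_rfl hi)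

/-- **The repeated squares**: `S_t` carries `z^(2^t) mod n` for `t < L` (`z < n`, `2n ≤ 2^L`).
[cite: Vollmer1999, §1.3] -/
theorem valS_eq (hL : 0 < L) (hz : valZ L inp < valN L inp) (hn : 2 * valN L inp ≤ 2 ^ L) :
    ∀ {t : ℕ}, t < L → valS L inp t = valZ L inp ^ 2 ^ t % valN L inp
  | 0, _ => by rw [valS_zero, Nat.pow_zero, Nat.pow_one, Nat.mod_eq_of_lt hz]
  | t + 1, ht => by
    have hNpos : 0 < valN L inp := by omega
    have ih := valS_eq hL hz hn (t := t) (by omega)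
    rw [valS_succ L inp hL ht (by rw [ih]; exact Nat.mod_lt _ hNpos) hn, ih, ← Nat.mul_mod, ← Nat.pow_add,
      ← two_mul, ← Nat.pow_succ']

/-- The inputs read by the mux row `G_t`: `(w_t, S_t, 1)`. [folklore] -/
def inpG (t : ℕ) (j : ℕ) : Bool :=
  if j = 0 then inp (L + t) else if j ≤ L then rv L inp (Sref L t (j - 1)) else rv L inp (ONEref L (j - 1 - L))

/-- **The mux row `G_t`** carries the wires of `muxRow L` on `(w_t, S_t, 1)`. [cite: Vollmer1999, Def. 1.7] -/
theorem wireVal_G (hL : 0 < L) {t : ℕ} (ht : t < L) {j : ℕ} (hj : j < L) :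
    wireVal (expT L) inp (oG L + t * L + j) = wireVal (ModAdd.muxRow L) (inpG L inp t) j := by
  have h := wireVal_piece L inp hL (k := L + t) (by omega) (j := j) (by rw [pieces_G L ht]; simpa using hj)
  rw [pieces_G L ht, offF_G L ht.le hL] at h
  refine h.trans (wireVal_congr (ModAdd.wf_muxRow L) (fun i hi => ?_) (by simpa using hj))
  show rv L inp (wG L t i) = inpG L inp t i
  unfold wG inpG; split_ifs <;> rfl

/-- **The selection**: `G_t` carries `S_t` if `w_t` is set and the word `1` otherwise (`t < L`).
[cite: Vollmer1999, §1.3] -/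
theorem valG_eq (hL : 0 < L) {t : ℕ} (ht : t < L) :
    valG L inp t = if inp (L + t) = true then valS L inp t else valONE L inp := by
  have h := ModAdd.wval_muxRow L (inpG L inp t)
  have h0 : inpG L inp t 0 = inp (L + t) := by simp [inpG]
  have h1 : wval (fun i => inpG L inp t (1 + i)) L = valS L inp t :=
    wval_congr fun i hi => by unfold inpG; rw [if_neg (by omega), if_pos (by omega), Nat.add_sub_cancel_left]
  have h2 : wval (fun i => inpG L inp t (1 + L + i)) L = valONE L inp :=
    wval_congr fun i hi => by unfold inpG; rw [if_neg (by omega), if_neg (by omega), show 1 + L + i - 1 - L = i by omega]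
  rw [h0, h1, h2] at h
  rw [← h]
  exact wval_congr fun i hi => by simp only [rv, Gref, refVal]; exact wireVal_G L inp hL ht hi

/-- The inputs read by the accumulation `F_{t+1}`: `(F_t, G_t, n)`. [folklore] -/
def inpF (t : ℕ) (i : ℕ) : Bool := if i < L then rv L inp (Fref L t i) else if i < 2 * L then rv L inp (Gref L t (i - L)) else inp i

/-- **The accumulation `F_{t+1}`** carries the wires of `mulRT L` on `(F_t, G_t, n)`.
[cite: Vollmer1999, Def. 1.7] -/
theorem wireVal_F (hL : 0 < L) {t : ℕ} (ht : t < L) {j : ℕ} (hj : j < (mulRT L).length) :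
    wireVal (expT L) inp (oF L + t * LD.RT L + j) = wireVal (mulRT L) (inpF L inp t) j := by
  have h := wireVal_piece L inp hL (k := 2 * L + t) (by omega) (j := j) (by rw [pieces_F L ht]; exact hj)
  rw [pieces_F L ht, offF_F L hL] at h
  refine h.trans (wireVal_congr (wf_mulRT L) (fun i hi => ?_) hj)
  show rv L inp (wF L t i) = inpF L inp t i
  unfold wF inpF; split_ifs <;> rfl

/-- The operands of `F_{t+1}` carry `F_t`, `G_t`, `n`. [folklore] -/
theorem val_inpF (t : ℕ) :
    ModMulU.valA L (inpF L inp t) = valF L inp t ∧ ModMulU.valB L (inpF L inp t) = valG L inp t ∧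
      ModMulU.valN L (inpF L inp t) = valN L inp := by
  refine ⟨wval_congr fun i hi => ?_, wval_congr fun i hi => ?_, wval_congr fun i hi => ?_⟩ <;> unfold inpF
  · rw [if_pos hi]
  · rw [if_neg (by omega), if_pos (by omega), Nat.add_sub_cancel_left]
  · rw [if_neg (by omega), if_neg (by omega)]

/-- **One accumulation step**: `F_{t+1} = (F_t · G_t) mod n` (for `F_t < n`, `2n ≤ 2^L`, `t < L`).
[cite: Vollmer1999, §1.3] -/
theorem valF_succ (hL : 0 < L) {t : ℕ} (ht : t < L) (hF : valF L inp t < valN L inp) (hn : 2 * valN L inp ≤ 2 ^ L) :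
    valF L inp (t + 1) = (valF L inp t * valG L inp t) % valN L inp := by
  obtain ⟨hA, hB, hN⟩ := val_inpF L inp t
  have h := wval_mulRT L (inpF L inp t) (by rw [hA, hN]; exact hF) (by rw [hN]; exact hn)
  rw [hA, hB, hN] at h
  rw [← h]
  refine wval_congr fun i hi => ?_
  have e : LD.pP L (oF L + (t + 1 - 1) * LD.RT L) L i = oF L + t * LD.RT L + posP L L i := by
    rw [pP_eq_posP, Nat.add_sub_cancel]
  simp only [rv, Fref, Nat.add_eq_zero_iff, one_ne_zero, and_false, if_false, refVal, e]
  exact wireVal_F L inp hL ht (posP_lt_length_mulRT L le_rfl hi)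

/-- **The invariant of square-and-multiply**: `F_t` carries `z^(w mod 2^t) mod n` for `t ≤ L`
(`z < n`, `2 ≤ n`, `2n ≤ 2^L`, zero input `zz = 0`). [cite: Vollmer1999, §1.3] -/
theorem valF_eq (hL : 0 < L) (hzz : inp (3 * L) = false) (hz : valZ L inp < valN L inp) (h2 : 2 ≤ valN L inp)
    (hn : 2 * valN L inp ≤ 2 ^ L) : ∀ {t : ℕ}, t ≤ L → valF L inp t = valZ L inp ^ (valW L inp % 2 ^ t) % valN L inp
  | 0, _ => by rw [valF_zero, valONE_eq L inp hL hzz, Nat.pow_zero, Nat.mod_one, Nat.pow_zero, Nat.mod_eq_of_lt h2]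
  | t + 1, ht => by
    have hNpos : 0 < valN L inp := by omega
    have ih := valF_eq hL hzz hz h2 hn (t := t) (by omega)
    have hbit : inp (L + t) = (valW L inp).testBit t := (testBit_wval (fun i => inp (L + i)) (W := L) (by omega)).symm
    rw [valF_succ L inp hL (by omega) (by rw [ih]; exact Nat.mod_lt _ hNpos) hn, ih, valG_eq L inp hL (by omega),
      Nat.mod_pow_succ, hbit]
    cases hb : (valW L inp).testBit t
    · have : valW L inp / 2 ^ t % 2 = 0 := by simpa [Nat.testBit_eq_decide_div_mod_eq] using hb
      rw [this, if_neg (by simp), valONE_eq L inp hL hzz, Nat.mul_one, Nat.mod_mod, Nat.mul_zero, Nat.add_zero]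
    · have : valW L inp / 2 ^ t % 2 = 1 := by simpa [Nat.testBit_eq_decide_div_mod_eq] using hb
      rw [this, if_pos rfl, valS_eq L inp hL hz hn (by omega), ← Nat.mul_mod, ← Nat.pow_add, Nat.mul_one]

/-- **The exponentiation kit computes `z ^ w mod n`**: the output word `F_L` of `expT L` — the
gates `LD.pP L (oF L + (L-1)·RT L) L i`, i.e. the variables `ModExpU.Fw L o L i` of an
occurrence `o` — carries `z ^ w mod n`, for `0 < L`, `z < n`, `2 ≤ n`, `2n ≤ 2^L` and zero
input `zz = 0`. [cite: Vollmer1999, §1.3] -/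
theorem wval_expT (hL : 0 < L) (hzz : inp (3 * L) = false) (hz : valZ L inp < valN L inp) (h2 : 2 ≤ valN L inp)
    (hn : 2 * valN L inp ≤ 2 ^ L) :
    wval (fun i => wireVal (expT L) inp (LD.pP L (oF L + (L - 1) * LD.RT L) L i)) L = valZ L inp ^ valW L inp % valN L inp := by
  have h := valF_eq L inp hL hzz hz h2 hn (t := L) le_rfl
  rw [Nat.mod_eq_of_lt (show valW L inp < 2 ^ L from wval_lt _ L)] at h
  rw [← h]
  exact wval_congr fun i _ => by simp only [rv, Fref, Nat.pos_iff_ne_zero.1 hL, if_false, refVal]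

/-- The output word of the kit is below `n`. [folklore] -/
theorem wval_expT_lt (hL : 0 < L) (hzz : inp (3 * L) = false) (hz : valZ L inp < valN L inp) (h2 : 2 ≤ valN L inp)
    (hn : 2 * valN L inp ≤ 2 ^ L) :
    wval (fun i => wireVal (expT L) inp (LD.pP L (oF L + (L - 1) * LD.RT L) L i)) L < valN L inp := by
  rw [wval_expT L inp hL hzz hz h2 hn]; exact Nat.mod_lt _ (by omega)

/-! ### The degenerate modulus `n = 1` -/

/-- At modulus `1`, one squaring of a word `≤ 1` gives the zero word. [folklore] -/
theorem valS_succ_of_n_one (hL : 0 < L) (hn : valN L inp = 1) {t : ℕ} (ht : t + 1 < L) (hS : valS L inp t ≤ 1) :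
    valS L inp (t + 1) = 0 := by
  obtain ⟨hA, hB, hN⟩ := val_inpS L inp t
  have h := wval_mulRT_of_n_one L (inpS L inp t) (by rw [hN, hn]) (by rw [hA]; exact hS) hL
  rw [← h]
  refine wval_congr fun i hi => ?_
  have e : LD.pP L (1 + (t + 1 - 1) * LD.RT L) L i = offF L (t + 1) + posP L L i := by
    rw [pP_eq_posP, offF_S L (by omega) (by omega)]
  simp only [rv, Sref, Nat.add_eq_zero_iff, one_ne_zero, and_false, if_false, refVal, e]
  exact wireVal_S L inp hL ht (posP_lt_length_mulRT L le_rfl hi)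

/-- At modulus `1` and base `z ≤ 1`, every repeated square is a word `≤ 1`. [folklore] -/
theorem valS_le_one_of_n_one (hL : 0 < L) (hn : valN L inp = 1) (hz : valZ L inp ≤ 1) : ∀ {t : ℕ}, t < L → valS L inp t ≤ 1
  | 0, _ => by rw [valS_zero]; exact hz
  | t + 1, ht => by rw [valS_succ_of_n_one L inp hL hn ht (valS_le_one_of_n_one hL hn hz (by omega))]; exact Nat.zero_le _

/-- At modulus `1`, one accumulation step from a word `≤ 1` gives the zero word. [folklore] -/
theorem valF_succ_of_n_one (hL : 0 < L) (hn : valN L inp = 1) {t : ℕ} (ht : t < L) (hF : valF L inp t ≤ 1) :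
    valF L inp (t + 1) = 0 := by
  obtain ⟨hA, hB, hN⟩ := val_inpF L inp t
  have h := wval_mulRT_of_n_one L (inpF L inp t) (by rw [hN, hn]) (by rw [hA]; exact hF) hL
  rw [← h]
  refine wval_congr fun i hi => ?_
  have e : LD.pP L (oF L + (t + 1 - 1) * LD.RT L) L i = oF L + t * LD.RT L + posP L L i := by
    rw [pP_eq_posP, Nat.add_sub_cancel]
  simp only [rv, Fref, Nat.add_eq_zero_iff, one_ne_zero, and_false, if_false, refVal, e]
  exact wireVal_F L inp hL ht (posP_lt_length_mulRT L le_rfl hi)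

/-- **At modulus `1` the exponentiation kit outputs the zero word** (`zz = 0`, any base and
exponent): `F₀ = 1`, and every later `F_t` is zero. This is the value `z ^ w mod 1 = 0`, outside
the hypotheses of `wval_expT`. [folklore] -/
theorem wval_expT_of_n_one (hL : 0 < L) (hzz : inp (3 * L) = false) (hn : valN L inp = 1) :
    wval (fun i => wireVal (expT L) inp (LD.pP L (oF L + (L - 1) * LD.RT L) L i)) L = 0 := by
  have hF : ∀ {t : ℕ}, t ≤ L → valF L inp t ≤ 1 ∧ (0 < t → valF L inp t = 0) := by
    intro t ht
    induction t with
    | zero => rw [valF_zero, valONE_eq L inp hL hzz]; exact ⟨le_rfl, fun h => absurd h (lt_irrefl 0)⟩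
    | succ t ih =>
      have h := valF_succ_of_n_one L inp hL hn (by omega) (ih (by omega)).1
      exact ⟨by rw [h]; exact Nat.zero_le _, fun _ => h⟩
  have h := (hF le_rfl).2 hL
  rw [← h]
  exact wval_congr fun i _ => by simp only [rv, Fref, Nat.pos_iff_ne_zero.1 hL, if_false, refVal]

end ModExpU

end Literature.Computability.MetaComplexity
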